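import Summits.BirchSwinnertonDyer.Rank1Residual.Supersingular.TowerSurjectivityOfRam
import Literature.NumberTheory.EllipticCurves.SemistablePeuRamifieRamifiedPrime
import HarnessLib

/-!
# Semistable X8: the `3`-adic tower from modularity + Ribet–Diamond level-lowering (no Lemma 20),
# and the census of the (ram@3) bit on X8
# (cell `b2b-bsdres`, supersingular family, prover B = unit `b2b-bsdres-additive-p3`, gen 16)

HONEST FRAMING (run/shared/lean/b2b/bsd-rank1-residual/, verbatim in every file): the goal of the
cell is to DELETE the COMBINATION-SHAPED residual classes of the Birch–Swinnerton-Dyer formula for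
ALL analytic-rank `≤ 1` elliptic curves over `ℚ` — "full BSD formula for every rank `≤ 1` curve in
class `C`" assembled STRICTLY from published theorems — so that the rank-`≤ 1` remainder becomes
exactly the CONSTRUCTION-SHAPED classes, which are TYPED (missing-input `Prop`s), NOT attempted.
This is not "finishing BSD". THEOREMS ONLY; the named facts taken are the standard binders `hmod`
(modularity, `exists_isNewformOf`) and `hLL` (`Literature.NumberTheory.Automorphic.diamond1995_refinedSerre`,
Diamond 1995 Thm. 1.1 / Ribet 1990 level-lowering) — both PUBLISHED; nothing about any particular
curve asserted; X8 stays CONSTRUCTION-SHAPED; nothing is booked.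

## What this file does

Companion of `Supersingular/TowerSurjectivityOfRam.lean` (same gen: the X8 ♯/♭ per-pair readings
with Wuthrich's Lemma 20 (registry A9) replaced by the census bit `Ram W 3` via the tree theorem
`hasSurjectiveModNGaloisRep_pow_of_hasMultiplicativeReductionAtPrime`). On SEMISTABLE X8 the bit
(ram@3) is itself a THEOREM granted `hmod` + `hLL`: the tree's `ram_of_semistable_of_irr_of_le_seven`
(semistable, `p ≤ 7` odd, `E[p]` irreducible ⟹ some `ℓ ‖ N` with `p ∤ ord_ℓ(Δ_min)` — otherwise
`ρ̄_{E,p}` is modular of level `1` and weight `≤ p + 1 ≤ 8 < 12`), with `E[3]` irreducible automatic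
on X8 (Serre Prop. 12, `ClassX8.irr'`). Hence `ClassX8.ram_of_semistable`,
`ClassX8.towerSurj_of_semistable` (the `3`-adic tower on EVERY semistable X8 curve from `hmod` +
`hLL`, no Lemma 20, no Elkies) and the `_of_levelLowering` twins of the rank-one λ-squeeze and the
rank-zero exact form.

CENSUS (this unit, gen 16; pure stdlib read of iw-2 `tables/ss500k_pairs.tsv` (cls = X8) × Cremona
`allcurves` a-invariants; `HOME/b2b-bsdres-additive-p3/g16/census/{ram3_census.py, x8_ram3.tsv,
summary.json, SHA256SUMS}`; nothing booked): (ram@3) holds on **2 897 / 3 211** X8 S-b pairs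
(N < 5·10⁵) — ALL **912** semistable ones (559 r0 + 353 r1, as the theorem predicts) and
**1 985 / 2 299** non-semistable (1 389 r0 + 596 r1), every one of them with surj(3); of the 314
pairs without it, 200 are 3Nn (no Kato/Kurihara lever anyway) and **114** (63 r0 + 51 r1) are
surj(3) pairs that keep the A9 binder. So after gen 16 Lemma 20 is needed on X8 only at those 114
S-b pairs.

References: [Ribet1990] Thm. 1.1; [Diamond1995RefinedSerre] Thm. 1.1; [Serre1972] §1.11 Prop. 12,
§5.4 Prop. 21 i); [SerreAbelianLadic1968] IV §3.4, A.1.2; [Sprung2012] Thm. 7.16, MC 7.21;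
[Wuthrich2014] Lemma 20 (p. 399).
-/

set_option autoImplicit false

noncomputable section

open scoped Classical MatrixGroups ModularForm

open CongruenceSubgroup WeierstrassCurve Literature.NumberTheory.EllipticCurves
  Literature.NumberTheory.EllipticCurves.ModularForms
  Literature.NumberTheory.EllipticCurves.Rank1Residual
  Literature.NumberTheory.EllipticCurves.Rank1Residual.Typed
  Literature.NumberTheory.EllipticCurves.Sprung2017
  Summit.BirchSwinnertonDyer.Rank1Residual.X1.MuLambda

namespace Summit.BirchSwinnertonDyer.Rank1Residual.Supersingular

/-! ### Semistable X8 — (ram@3) from Ribet–Diamond level-lowering -/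

section Semistable

variable (W : WeierstrassCurve ℚ) [W.IsElliptic] [W.IsGloballyMinimal] (p : ℕ) [Fact p.Prime]

/-- **X8 ∧ sst ⟹ (ram@3)**, granted modularity (`hmod`) and Diamond's refined Serre / Ribet's
level-lowering (`hLL`): a semistable curve with `E[3]` irreducible (automatic on X8, Serre Prop. 12)
has a multiplicative prime `ℓ` with `3 ∤ ord_ℓ(Δ_min)` — otherwise `ρ̄_{E,3}` would be modular of
level `1` and weight `≤ 4 < 12` (tree theorem `ram_of_semistable_of_irr_of_le_seven`).
[cite: Ribet1990, Thm. 1.1] [cite: Diamond1995RefinedSerre, Thm. 1.1] [cite: Serre1972, §1.11 Prop. 12] -/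
theorem ClassX8.ram_of_semistable (hmod : exists_isNewformOf) (hLL : Literature.NumberTheory.Automorphic.diamond1995_refinedSerre)
    (hX : ClassX8 W p) (hsst : Semistable W) : Ram W p := by
  have hirr : Irr W p := ClassX8.irr' W p hX
  have hp3 : p = 3 := hX.1
  subst hp3
  exact ram_of_semistable_of_irr_of_le_seven hmod hLL W 3 (by decide) (by decide) hsst hirr

/-- **X8 ∧ sst ⟹ the `3`-adic tower `∀ n, ρ̄_{E,3ⁿ}` onto**, granted `hmod` + `hLL` (no Lemma 20,
no Elkies): surj(3) by Serre Prop. 21 i), (ram@3) by level-lowering, then Serre's transvection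
lifting. [cite: Ribet1990, Thm. 1.1] [cite: Diamond1995RefinedSerre, Thm. 1.1]
[cite: Serre1972, §5.4 Prop. 21 i)] [cite: SerreAbelianLadic1968, Ch. IV §3.4 and A.1.2] -/
theorem ClassX8.towerSurj_of_semistable (hmod : exists_isNewformOf) (hLL : Literature.NumberTheory.Automorphic.diamond1995_refinedSerre)
    (hX : ClassX8 W p) (hsst : Semistable W) (n : ℕ) : W.HasSurjectiveModNGaloisRep (p ^ n : ℕ) :=
  ClassX8.towerSurj_of_semistable_of_ram W p hX hsst (ClassX8.ram_of_semistable W p hmod hLL hX hsst) n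

/-- **X8 ∩ {sst} ∧ `r_an = 1`: the ♯/♭ main conjecture AT THE PAIR from the λ-certificate, with the
image binder supplied by `hmod` + `hLL` instead of Lemma 20.** [cite: Sprung2012, Thm. 7.16, Prop. 7.19, Main Conj. 7.21 (pp. 1504–1505)]
[cite: Sprung2024, Lemma 5.6 (p. 41)] [cite: Ribet1990, Thm. 1.1] [cite: Diamond1995RefinedSerre, Thm. 1.1] -/
theorem X8.charIdealEq_of_lam_eq_one_of_semistable_of_analyticRank_eq_one_of_levelLowering
    (hmod : exists_isNewformOf) (hLL : Literature.NumberTheory.Automorphic.diamond1995_refinedSerre)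
    (hGZK : rank_eq_analyticRank_of_analyticRank_le_one)
    (hX : ClassX8 W p) (hsst : Semistable W) (h1 : W.analyticRank = 1)
    (D : SignedDatum W p) (hC : D.OrderOfVanishing)
    (hKato : (∀ n : ℕ, W.HasSurjectiveModNGaloisRep (p ^ n : ℕ)) → D.UpperDivisibility)
    (hμ : mu D.L = 0) (hlam : lam D.L = 1) : D.CharIdealEq :=
  X8.charIdealEq_of_lam_eq_one_of_analyticRank_eq_one_of_tower W p hGZK hX
    (ClassX8.towerSurj_of_semistable W p hmod hLL hX hsst) h1 D hC hKato hμ hlam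

/-- **X8 ∩ {sst} ∧ `r_an = 0`: `BSD(E,3) ⟺ (ξ•) = (L•_3(E))`, image binder from `hmod` + `hLL`
instead of Lemma 20.** PER PAIR. [cite: Sprung2012, Thm. 7.16 and Main Conj. 7.21 (pp. 1504–1505)]
[cite: Sprung2024, Lemmas 5.5–5.9 (pp. 40–41)] [cite: Ribet1990, Thm. 1.1] [cite: Diamond1995RefinedSerre, Thm. 1.1] -/
theorem X8.bsdp_iff_span_eq_span_chromaticL_of_semistable_of_analyticRank_eq_zero_of_levelLowering
    (h3 : realPeriodRat_eq_unit_mul_plusPeriod_three) (hLL : Literature.NumberTheory.Automorphic.diamond1995_refinedSerre)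
    (hGZK : rank_eq_analyticRank_of_analyticRank_le_one) (hmod' : exists_isNewformOf)
    (hmod : hasEntireLFunction_rat)
    (hX : ClassX8 W p) (hsst : Semistable W) (h0 : W.analyticRank = 0)
    {N : ℕ} [NeZero N] {f : CuspForm (Gamma0 N) 2} (hf : IsNewformOf W f)
    {Lsharp Lflat : IwasawaAlgebra p} (hSP : IsSprungPair f p (W.frobeniusTrace p) Lsharp Lflat)
    (c : Chroma) (ξ : IwasawaAlgebra p) (hK : (⟨ξ, 0, 0⟩ : SignedDatum W p).EulerCharacteristic)
    (hKato : (∀ n : ℕ, W.HasSurjectiveModNGaloisRep (p ^ n : ℕ)) → ξ ∣ chromaticL c Lsharp Lflat) :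
    BSDp W p ↔ Ideal.span ({ξ} : Set (IwasawaAlgebra p)) = Ideal.span {chromaticL c Lsharp Lflat} :=
  X8.bsdp_iff_span_eq_span_chromaticL_of_analyticRank_eq_zero_of_tower W p h3 hGZK hmod hX
    (ClassX8.towerSurj_of_semistable W p hmod' hLL hX hsst) h0 hf hSP c ξ hK hKato

end Semistable

end Summit.BirchSwinnertonDyer.Rank1Residual.Supersingular

end
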